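import Mathlib
import Summits.NavierStokesRegularity.NavierStokesRegularity.Theses.OrthantWake
import Literature.Analysis.FluidPDE.TaoCascadeNoLow
import Literature.Analysis.FluidPDE.Tao2016AveragedNS.ViscousEnvelopeSmoothing
import Literature.Analysis.FluidPDE.Tao2016AveragedNS.SelfSimilarCascadeBlowup
import HarnessLib

/-!
# `OrthantWake.OrthantBreakOfWake` — the tail-energy ratchet and cone invariance give global
pseudo-solutions for orthant tables (item stmt-NavierStokesRegularity-24641; glue with content)

**Statement (verbatim route decl).** `OrthantHopWake → OrthantInvariance → ∀ R ≥ 1, ∃ εR > 0,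
∀ ε₀ ∈ (0, εR], ∀ α ∈ E₂(R) orthant, ∀ X₀, ¬ NoGlobalCascade ε₀ α X₀`.

PROOF. Fix `R ≥ 1`; `OrthantHopWake` gives `η, κ₁, ε̄`; take `εR = ε̄`. For `ε₀ ≤ ε̄`, an orthant
table `α ∈ E₂(R)` and a datum `X₀`, suppose `NoGlobalCascade ε₀ α X₀`; by the κ-normal form
(`noGlobalCascade_iff_kappa`) some defect level `κ > 0` carries no global pseudo-solution. Put
`ν = κ/√2`. We verify the hypothesis of the tree's envelope-smoothing theorem
`exists_viscousGlobal_of_subcriticalEnvelope_of_inTableClass` with the constant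
`C = E₀ (1+ε₀)^{(1+η) n₁}`, `E₀ = Σ_i ½ X₀_i²`, `n₁ = ⌈κ₁/ε₀⌉` (INDEPENDENT of the horizon): for a
regular `ν`-viscous solution `X` on `[0,s]`,
* ENERGY (`orthantBreak_energy_le`): the total energy `Σ_k Σ_i ½X_{i,k}(t)²` is `≤ E₀` — finite
  partial energies have derivative = boundary flux `topSum` (Tao's telescoping under the
  cancellation (4.3), `sum_range_sum_quadTerm_mul`) minus dissipation, the boundary flux at shell
  `L` is `O((1+ε₀)^{-20L})` by the (4.5) weight bound, and one passes to the limit `L → ∞`;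
* CONE: `OrthantInvariance` gives `X ≥ 0` on shells `≥ 1`, so `OrthantHopWake` applies;
* RATCHET ⇒ ENVELOPE (`orthantBreak_envelope`): tails are `≤ E₀`; beyond `n₁` each hop loses the
  factor `(1+ε₀)^{-(1+η)}` (induction on the shell, no running maximum needed since the bound is
  uniform in time), hence `T_n(t) ≤ C (1+ε₀)^{-(1+η)n}` for all `n`, and finite partial sums are
  below the tail.
The smoothing theorem then yields a global regular viscous solution, which is a global
`(κ, κ)`-pseudo-solution (`hasGlobal_of_viscousGlobal`, `hasGlobal_mono`) — contradiction.

HONEST FRAMING: statements about Tao-type MODEL lattice ODEs (route OrthantWake, rung TL-M2Break);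
both hypotheses remain hypotheses (OrthantHopWake is the open crux); nothing here bears on
Navier–Stokes regularity and no summit is proved.
-/

noncomputable section

-- the sub-problem namespace `NavierStokesRegularity.NavierStokesRegularity` is the tree's layout (D-0017)
set_option linter.dupNamespace false

namespace Summit.NavierStokesRegularity.NavierStokesRegularity.Theorems

open Set Filter
open scoped Topology
open Literature.Analysis.FluidPDE.TaoCascade

/-! ## Decay of the modes from the (4.5) weight bound; summable tail energies -/

/-- From the a priori bound `(1 + (1+ε₀)^{10m}) |x| ≤ M` on a shell `m ≥ j` one gets
`|x| ≤ M q^j` with `q = (1+ε₀)^{-10}`. [this file] -/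
theorem orthantBreak_abs_le {ε₀ M x : ℝ} (hε : 0 < ε₀) {m : ℤ} {j : ℕ} (hmj : (j : ℤ) ≤ m)
    (hx : (1 + (1 + ε₀) ^ ((10 : ℝ) * m)) * |x| ≤ M) :
    |x| ≤ M * (((1 + ε₀) ^ (10 : ℝ))⁻¹) ^ j := by
  have h0 : (0 : ℝ) < 1 + ε₀ := by linarith
  have h1 : (1 : ℝ) ≤ 1 + ε₀ := by linarith
  have hq : 0 < (1 + ε₀) ^ (10 : ℝ) := Real.rpow_pos_of_pos h0 _
  have hpow : ((1 + ε₀) ^ (10 : ℝ)) ^ j = (1 + ε₀) ^ ((10 : ℝ) * j) := by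
    rw [← Real.rpow_natCast, ← Real.rpow_mul h0.le]
  have hjm : (j : ℝ) ≤ (m : ℝ) := by exact_mod_cast hmj
  have hle : ((1 + ε₀) ^ (10 : ℝ)) ^ j * |x| ≤ M := by
    calc ((1 + ε₀) ^ (10 : ℝ)) ^ j * |x| = (1 + ε₀) ^ ((10 : ℝ) * j) * |x| := by rw [hpow]
      _ ≤ (1 + ε₀) ^ ((10 : ℝ) * m) * |x| :=
          mul_le_mul_of_nonneg_right (Real.rpow_le_rpow_of_exponent_le h1 (by linarith))
            (abs_nonneg x)
      _ ≤ (1 + (1 + ε₀) ^ ((10 : ℝ) * m)) * |x| :=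
          mul_le_mul_of_nonneg_right (by linarith [Real.rpow_nonneg h0.le ((10 : ℝ) * m)])
            (abs_nonneg x)
      _ ≤ M := hx
  rw [inv_pow, ← div_eq_mul_inv, le_div_iff₀ (pow_pos hq j)]
  calc |x| * ((1 + ε₀) ^ (10 : ℝ)) ^ j = ((1 + ε₀) ^ (10 : ℝ)) ^ j * |x| := mul_comm _ _
    _ ≤ M := hle

/-- The tail energies `j ↦ Σ_i ½ X_{i,a+j}(t)²` of a family with the (4.5) weight bound are
summable (dominated by a geometric series of ratio `(1+ε₀)^{-20}`). [this file] -/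
theorem orthantBreak_summable {ε₀ M : ℝ} (hε : 0 < ε₀) {X : Fin 4 → ℤ → ℝ → ℝ}
    (hM : ∀ (t : ℝ) (i : Fin 4) (k : ℤ), (1 + (1 + ε₀) ^ ((10 : ℝ) * k)) * |X i k t| ≤ M)
    (a : ℕ) (t : ℝ) :
    Summable fun j : ℕ => ∑ i : Fin 4, (1 / 2 : ℝ) * X i ((a : ℤ) + (j : ℤ)) t ^ 2 := by
  have h0 : (0 : ℝ) < 1 + ε₀ := by linarith
  set q : ℝ := ((1 + ε₀) ^ (10 : ℝ))⁻¹ with hq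
  have hq0 : 0 ≤ q := inv_nonneg.2 (Real.rpow_nonneg h0.le _)
  have hq1 : q < 1 := inv_lt_one_of_one_lt₀ (Real.one_lt_rpow (by linarith) (by norm_num))
  have hterm : ∀ j : ℕ, ∑ i : Fin 4, (1 / 2 : ℝ) * X i ((a : ℤ) + (j : ℤ)) t ^ 2 ≤
      2 * M ^ 2 * (q ^ 2) ^ j := by
    intro j
    have hb : ∀ i : Fin 4, (1 / 2 : ℝ) * X i ((a : ℤ) + (j : ℤ)) t ^ 2 ≤
        (1 / 2) * (M * q ^ j) ^ 2 := by
      intro i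
      have h := orthantBreak_abs_le hε (m := (a : ℤ) + j) (j := j) (by omega) (hM t i _)
      have h2 : X i ((a : ℤ) + (j : ℤ)) t ^ 2 ≤ (M * q ^ j) ^ 2 := by
        rw [← sq_abs]
        exact pow_le_pow_left₀ (abs_nonneg _) h 2
      linarith
    calc ∑ i : Fin 4, (1 / 2 : ℝ) * X i ((a : ℤ) + (j : ℤ)) t ^ 2
        ≤ ∑ _i : Fin 4, (1 / 2 : ℝ) * (M * q ^ j) ^ 2 := Finset.sum_le_sum fun i _ => hb i
      _ = 2 * M ^ 2 * (q ^ 2) ^ j := by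
          rw [Finset.sum_const, Finset.card_univ, Fintype.card_fin, nsmul_eq_mul]
          push_cast
          ring
  refine Summable.of_nonneg_of_le (fun j => Finset.sum_nonneg fun i _ => by positivity) hterm ?_
  exact (summable_geometric_of_lt_one (sq_nonneg q) (pow_lt_one₀ hq0 hq1 two_ne_zero)).mul_left _

/-- Tails of a non-negative summable series are below the full sum. [this file] -/
theorem orthantBreak_tail_le {f : ℕ → ℝ} (hf : ∀ j, 0 ≤ f j) (hs : Summable f) (n : ℕ) :
    ∑' j, f (n + j) ≤ ∑' j, f j := by
  have h := hs.sum_add_tsum_nat_add n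
  have h2 : ∑' j, f (n + j) = ∑' j, f (j + n) := tsum_congr fun j => by rw [add_comm]
  have h3 : 0 ≤ ∑ i ∈ Finset.range n, f i := Finset.sum_nonneg fun i _ => hf i
  linarith

/-- A finite block `Σ_{k=n}^{N} f k` of a non-negative series is below the tail `Σ_j f (n+j)`.
[this file] -/
theorem orthantBreak_partial_le {f : ℕ → ℝ} (hf : ∀ j, 0 ≤ f j) (n N : ℕ)
    (hs : Summable fun j => f (n + j)) :
    ∑ k ∈ Finset.Icc n N, f k ≤ ∑' j, f (n + j) := by
  have hI : Finset.Icc n N = Finset.Ico n (N + 1) := by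
    ext k
    simp only [Finset.mem_Icc, Finset.mem_Ico]
    omega
  rw [hI, Finset.sum_Ico_eq_sum_range]
  exact hs.sum_le_tsum _ fun j _ => hf _

/-! ## Energy monotonicity of the viscous lattice of a cancelling table -/

/-- **Energy bound.** For a cancelling table (Tao 2016 (4.3)) and a regular solution of the
`ν`-viscous lattice on `[0,s]` from a one-shell datum `X₀` at shell `0` (vanishing below shell
`0`, (4.5) weight bound), the total energy at every time `t ∈ [0,s]` is at most the initial
energy: `Σ_k Σ_i ½ X_{i,k}(t)² ≤ Σ_i ½ X₀_i²`. Proof: the partial energy over shells `0..L` has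
derivative `topSum(L) − dissipation` (telescoping `sum_range_sum_quadTerm_mul`; the flux below
shell `0` vanishes), `|topSum(L)| ≤ (Σ|α|) M³ (1+ε₀)^{-20L}` by the weight bound, so
`E_L(t) ≤ E₀ + δ_L t` with `δ_L → 0`; let `L → ∞`. [this file] -/
theorem orthantBreak_energy_le {ε₀ ν s M : ℝ} (hε : 0 < ε₀) (hν : 0 < ν)
    {α : Fin 4 → Fin 4 → Fin 4 → ℤ × ℤ × ℤ → ℝ} (hc : IsCancellingCoeff α)
    {X₀ : Fin 4 → ℝ} {X : Fin 4 → ℤ → ℝ → ℝ}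
    (hinit : ∀ (i : Fin 4) (k : ℤ), X i k 0 = if k = 0 then X₀ i else 0)
    (hlow : ∀ (i : Fin 4) (k : ℤ), k < 0 → ∀ t : ℝ, X i k t = 0)
    (hM : ∀ (t : ℝ) (i : Fin 4) (k : ℤ), (1 + (1 + ε₀) ^ ((10 : ℝ) * k)) * |X i k t| ≤ M)
    (hder : ∀ (i : Fin 4) (k : ℤ), ∀ t ∈ Icc (0 : ℝ) s, HasDerivWithinAt (X i k)
      (quadTerm ε₀ α X i k t - ν * (1 + ε₀) ^ ((2 : ℝ) * k) * X i k t) (Icc (0 : ℝ) s) t)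
    {t : ℝ} (ht : t ∈ Icc (0 : ℝ) s) :
    ∑' j : ℕ, ∑ i : Fin 4, (1 / 2 : ℝ) * X i (j : ℤ) t ^ 2 ≤
      ∑ i : Fin 4, (1 / 2 : ℝ) * X₀ i ^ 2 := by
  have h0 : (0 : ℝ) < 1 + ε₀ := by linarith
  have h1 : (1 : ℝ) ≤ 1 + ε₀ := by linarith
  have hM0 : 0 ≤ M :=
    le_trans (mul_nonneg (add_nonneg zero_le_one (Real.rpow_nonneg h0.le _)) (abs_nonneg _))
      (hM t 0 0)
  set q : ℝ := ((1 + ε₀) ^ (10 : ℝ))⁻¹ with hq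
  have hq10 : 0 < (1 + ε₀) ^ (10 : ℝ) := Real.rpow_pos_of_pos h0 _
  have hq0 : 0 ≤ q := inv_nonneg.2 hq10.le
  have hq1 : q < 1 := inv_lt_one_of_one_lt₀ (Real.one_lt_rpow (by linarith) (by norm_num))
  -- partial energies over the shells `0..L` and their derivatives
  set E : ℕ → ℝ → ℝ := fun L u =>
    ∑ k ∈ Finset.range (L + 1), ∑ i : Fin 4, (1 / 2 : ℝ) * X i (k : ℤ) u ^ 2 with hE
  set D : ℕ → ℝ → ℝ := fun L u => ∑ k ∈ Finset.range (L + 1), ∑ i : Fin 4,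
    X i (k : ℤ) u * (quadTerm ε₀ α X i k u - ν * (1 + ε₀) ^ ((2 : ℝ) * (k : ℤ)) * X i k u)
    with hD
  have hderE : ∀ (L : ℕ), ∀ u ∈ Icc (0 : ℝ) s, HasDerivWithinAt (E L) (D L u) (Icc 0 s) u := by
    intro L u hu
    simp only [hE, hD]
    refine HasDerivWithinAt.fun_sum fun k _ => HasDerivWithinAt.fun_sum fun i _ => ?_
    have h := ((hder i k u hu).pow 2).const_mul (1 / 2 : ℝ)
    refine h.congr_deriv ?_
    rw [show (2 : ℕ) - 1 = 1 from rfl, pow_one]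
    push_cast
    ring
  -- the derivative is the boundary flux at shell `L` minus dissipation
  set δ : ℕ → ℝ := fun L => coeffAbs α * M ^ 3 * (q ^ 2) ^ L with hδ
  have hDle : ∀ (L : ℕ) (u : ℝ), D L u ≤ δ L := by
    intro L u
    have hstep1 : D L u ≤ ∑ k ∈ Finset.range (L + 1), ∑ i : Fin 4,
        quadTerm ε₀ α X i ((0 : ℤ) + k) u * X i ((0 : ℤ) + k) u := by
      simp only [hD, zero_add]
      refine Finset.sum_le_sum fun k _ => Finset.sum_le_sum fun i _ => ?_
      have hν' : 0 ≤ ν * (1 + ε₀) ^ ((2 : ℝ) * (k : ℤ)) * X i k u ^ 2 :=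
        mul_nonneg (mul_nonneg hν.le (Real.rpow_nonneg h0.le _)) (sq_nonneg _)
      nlinarith [hν']
    rw [sum_range_sum_quadTerm_mul ε₀ hc X 0 (L + 1) u] at hstep1
    have hX1 : ∀ (i : Fin 4) (w : ℝ), X i (-1) w = 0 := fun i w => hlow i (-1) (by norm_num) w
    have htop0 : topSum ε₀ α X (0 - 1) u = 0 := by
      simp [topSum, hX1]
    have hidx : (0 : ℤ) + ((L + 1 : ℕ) : ℤ) - 1 = (L : ℤ) := by push_cast; ring
    rw [htop0, sub_zero, hidx] at hstep1
    have hXb : ∀ i : Fin 4, |X i (L : ℤ) u| ≤ M * q ^ L ∧ |X i ((L : ℤ) + 1) u| ≤ M * q ^ L :=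
      fun i => ⟨orthantBreak_abs_le hε (by omega) (hM u i _),
        orthantBreak_abs_le hε (by omega) (hM u i _)⟩
    have htop := abs_topSum_le ε₀ h0 α X (L : ℤ) u (mul_nonneg hM0 (pow_nonneg hq0 L)) hXb
    have hgain : (1 + ε₀) ^ ((5 : ℝ) * ((L : ℤ) : ℝ) / 2) ≤ ((1 + ε₀) ^ (10 : ℝ)) ^ L := by
      rw [← Real.rpow_natCast, ← Real.rpow_mul h0.le]
      push_cast
      exact Real.rpow_le_rpow_of_exponent_le h1
        (by linarith [(Nat.cast_nonneg L : (0 : ℝ) ≤ L)])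
    have hcA := coeffAbs_nonneg α
    have hPL : ((1 + ε₀) ^ (10 : ℝ)) ^ L * q ^ L = 1 := by
      rw [← mul_pow, hq, mul_inv_cancel₀ hq10.ne', one_pow]
    calc D L u ≤ topSum ε₀ α X (L : ℤ) u := hstep1
      _ ≤ |topSum ε₀ α X (L : ℤ) u| := le_abs_self _
      _ ≤ (1 + ε₀) ^ ((5 : ℝ) * ((L : ℤ) : ℝ) / 2) * (M * q ^ L) ^ 3 * coeffAbs α := htop
      _ ≤ ((1 + ε₀) ^ (10 : ℝ)) ^ L * (M * q ^ L) ^ 3 * coeffAbs α :=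
          mul_le_mul_of_nonneg_right
            (mul_le_mul_of_nonneg_right hgain (pow_nonneg (mul_nonneg hM0 (pow_nonneg hq0 L)) 3))
            hcA
      _ = coeffAbs α * M ^ 3 * ((((1 + ε₀) ^ (10 : ℝ)) ^ L * q ^ L) * (q ^ L) ^ 2) := by ring
      _ = δ L := by simp only [hδ, hPL]; ring
  -- integrate on `[0, t]`
  have hEt : ∀ L : ℕ, E L t ≤ E L 0 + δ L * t := by
    intro L
    have hcont : ContinuousOn (E L) (Icc 0 s) := fun u hu => (hderE L u hu).continuousWithinAt
    have hdiff : DifferentiableOn ℝ (E L) (interior (Icc 0 s)) := by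
      intro u hu
      rw [interior_Icc] at hu
      exact ((hderE L u ⟨hu.1.le, hu.2.le⟩).hasDerivAt
        (Icc_mem_nhds hu.1 hu.2)).differentiableAt.differentiableWithinAt
    have hle : ∀ u ∈ interior (Icc (0 : ℝ) s), deriv (E L) u ≤ δ L := by
      intro u hu
      rw [interior_Icc] at hu
      rw [((hderE L u ⟨hu.1.le, hu.2.le⟩).hasDerivAt (Icc_mem_nhds hu.1 hu.2)).deriv]
      exact hDle L u
    have h := (convex_Icc (0 : ℝ) s).image_sub_le_mul_sub_of_deriv_le hcont hdiff hle 0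
      (left_mem_Icc.2 (ht.1.trans ht.2)) t ht ht.1
    linarith
  -- the initial partial energy is the energy of the datum
  have hE0 : ∀ L : ℕ, E L 0 = ∑ i : Fin 4, (1 / 2 : ℝ) * X₀ i ^ 2 := by
    intro L
    simp only [hE]
    have hz : ∑ k ∈ Finset.range L, ∑ i : Fin 4,
        (1 / 2 : ℝ) * X i ((k + 1 : ℕ) : ℤ) 0 ^ 2 = 0 :=
      Finset.sum_eq_zero fun k _ => Finset.sum_eq_zero fun i _ => by
        rw [hinit, if_neg (by push_cast; omega)]
        ring
    rw [Finset.sum_range_succ', hz, zero_add]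
    refine Finset.sum_congr rfl fun i _ => ?_
    rw [Nat.cast_zero, hinit, if_pos rfl]
  -- pass to the limit `L → ∞`
  have hsum : Summable fun j : ℕ => ∑ i : Fin 4, (1 / 2 : ℝ) * X i (j : ℤ) t ^ 2 :=
    (orthantBreak_summable hε hM 0 t).congr fun j => by simp
  have hlim1 : Tendsto (fun L : ℕ => E L t) atTop
      (𝓝 (∑' j : ℕ, ∑ i : Fin 4, (1 / 2 : ℝ) * X i (j : ℤ) t ^ 2)) :=
    hsum.tendsto_sum_tsum_nat.comp (tendsto_add_atTop_nat 1)
  have hlim2 : Tendsto (fun L : ℕ => E L 0 + δ L * t) atTop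
      (𝓝 (∑ i : Fin 4, (1 / 2 : ℝ) * X₀ i ^ 2 + 0 * t)) := by
    simp only [hE0]
    refine tendsto_const_nhds.add (Tendsto.mul_const _ ?_)
    have := (tendsto_pow_atTop_nhds_zero_of_lt_one (sq_nonneg q)
      (pow_lt_one₀ hq0 hq1 two_ne_zero)).const_mul (coeffAbs α * M ^ 3)
    simpa using this
  have := le_of_tendsto_of_tendsto' hlim1 hlim2 hEt
  simpa using this

/-! ## From the per-hop ratchet to the subcritical envelope -/

/-- **Ratchet ⇒ envelope.** If the tail energies `T_a(u) = Σ_j Σ_i ½X_{i,a+j}(u)²` are summable,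
the total energy is `≤ E₀` on `[0,s]`, and beyond the transient depth (`ε₀ n ≥ κ₁`, in particular
for `n ≥ n₁` when `κ₁ ≤ ε₀ n₁`) every hop ratchets down by `(1+ε₀)^{-(1+η)}` against an earlier
time, then every finite block of shell energies obeys the subcritical envelope
`Σ_{k=n}^{N} Σ_i ½X_{i,k}(t)² ≤ E₀ (1+ε₀)^{(1+η)n₁} (1+ε₀)^{-(1+η)n}`. [this file] -/
theorem orthantBreak_envelope {ε₀ η κ₁ s E₀ : ℝ} (hε : 0 < ε₀) {n₁ : ℕ} (hn₁ : κ₁ ≤ ε₀ * n₁)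
    {X : Fin 4 → ℤ → ℝ → ℝ}
    (hsum : ∀ (a : ℕ) (t : ℝ),
      Summable fun j : ℕ => ∑ i : Fin 4, (1 / 2 : ℝ) * X i ((a : ℤ) + (j : ℤ)) t ^ 2)
    (hE : ∀ t ∈ Icc (0 : ℝ) s, ∑' j : ℕ, ∑ i : Fin 4, (1 / 2 : ℝ) * X i (j : ℤ) t ^ 2 ≤ E₀)
    (hratchet : ∀ n : ℕ, κ₁ ≤ ε₀ * n → ∀ t ∈ Icc (0 : ℝ) s, ∃ u ∈ Icc (0 : ℝ) t,
      (∑' j : ℕ, ∑ i : Fin 4, (1 / 2 : ℝ) * X i ((n + 1 : ℕ) + (j : ℤ)) t ^ 2) ≤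
        (1 + ε₀) ^ (-(1 + η)) *
          (∑' j : ℕ, ∑ i : Fin 4, (1 / 2 : ℝ) * X i ((n : ℕ) + (j : ℤ)) u ^ 2))
    (hη : 0 < η) (n N : ℕ) {t : ℝ} (ht : t ∈ Icc (0 : ℝ) s) :
    ∑ k ∈ Finset.Icc n N, ∑ i : Fin 4, (1 / 2 : ℝ) * X i (k : ℤ) t ^ 2 ≤
      (E₀ * (1 + ε₀) ^ ((1 + η) * n₁)) * (1 + ε₀) ^ (-((1 + η) * (n : ℝ))) := by
  have h0 : (0 : ℝ) < 1 + ε₀ := by linarith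
  have h1 : (1 : ℝ) ≤ 1 + ε₀ := by linarith
  set T : ℕ → ℝ → ℝ := fun a u =>
    ∑' j : ℕ, ∑ i : Fin 4, (1 / 2 : ℝ) * X i ((a : ℤ) + (j : ℤ)) u ^ 2 with hT
  have hnonneg : ∀ (u : ℝ) (j : ℕ), 0 ≤ ∑ i : Fin 4, (1 / 2 : ℝ) * X i (j : ℤ) u ^ 2 :=
    fun u j => Finset.sum_nonneg fun i _ => by positivity
  -- every tail is below the total energy
  have hTle : ∀ (a : ℕ), ∀ u ∈ Icc (0 : ℝ) s, T a u ≤ E₀ := by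
    intro a u hu
    have hs0 : Summable fun j : ℕ => ∑ i : Fin 4, (1 / 2 : ℝ) * X i (j : ℤ) u ^ 2 :=
      (hsum 0 u).congr fun j => by simp
    have h := orthantBreak_tail_le (hnonneg u) hs0 a
    have h2 : T a u = ∑' j : ℕ, ∑ i : Fin 4, (1 / 2 : ℝ) * X i ((a + j : ℕ) : ℤ) u ^ 2 := by
      simp only [hT, Nat.cast_add]
    rw [h2]
    exact h.trans (hE u hu)
  have hE0 : 0 ≤ E₀ := (tsum_nonneg (hnonneg t)).trans (hE t ht)
  -- iterate the ratchet from the transient depth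
  have hiter : ∀ d : ℕ, ∀ u ∈ Icc (0 : ℝ) s,
      T (n₁ + d) u ≤ E₀ * (1 + ε₀) ^ (-((1 + η) * (d : ℝ))) := by
    intro d
    induction d with
    | zero =>
      intro u hu
      simpa using hTle n₁ u hu
    | succ d ih =>
      intro u hu
      have hnd : κ₁ ≤ ε₀ * ((n₁ + d : ℕ) : ℝ) := by
        push_cast
        linarith [mul_add ε₀ (n₁ : ℝ) (d : ℝ),
          mul_nonneg hε.le (Nat.cast_nonneg d : (0 : ℝ) ≤ (d : ℝ))]
      obtain ⟨v, hv, hle⟩ := hratchet (n₁ + d) hnd u hu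
      have hv' : v ∈ Icc (0 : ℝ) s := ⟨hv.1, hv.2.trans hu.2⟩
      have h3 := ih v hv'
      have hr : 0 ≤ (1 + ε₀) ^ (-(1 + η)) := Real.rpow_nonneg h0.le _
      have hexp : -((1 + η) * ((d + 1 : ℕ) : ℝ)) = -(1 + η) + -((1 + η) * (d : ℝ)) := by
        push_cast
        ring
      calc T (n₁ + (d + 1)) u = T (n₁ + d + 1) u := rfl
        _ ≤ (1 + ε₀) ^ (-(1 + η)) * T (n₁ + d) v := hle
        _ ≤ (1 + ε₀) ^ (-(1 + η)) * (E₀ * (1 + ε₀) ^ (-((1 + η) * (d : ℝ)))) :=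
            mul_le_mul_of_nonneg_left h3 hr
        _ = E₀ * (1 + ε₀) ^ (-((1 + η) * ((d + 1 : ℕ) : ℝ))) := by
            rw [hexp, Real.rpow_add h0]
            ring
  -- the envelope for every shell
  have hTall : ∀ (a : ℕ), ∀ u ∈ Icc (0 : ℝ) s,
      T a u ≤ (E₀ * (1 + ε₀) ^ ((1 + η) * n₁)) * (1 + ε₀) ^ (-((1 + η) * (a : ℝ))) := by
    intro a u hu
    rcases le_or_gt n₁ a with hle | hlt
    · obtain ⟨d, rfl⟩ := Nat.exists_eq_add_of_le hle
      have h := hiter d u hu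
      have hexp : (1 + η) * (n₁ : ℝ) + -((1 + η) * ((n₁ + d : ℕ) : ℝ)) =
          -((1 + η) * (d : ℝ)) := by
        push_cast
        ring
      calc T (n₁ + d) u ≤ E₀ * (1 + ε₀) ^ (-((1 + η) * (d : ℝ))) := h
        _ = (E₀ * (1 + ε₀) ^ ((1 + η) * n₁)) *
              (1 + ε₀) ^ (-((1 + η) * ((n₁ + d : ℕ) : ℝ))) := by
            rw [mul_assoc, ← Real.rpow_add h0, hexp]
    · have h := hTle a u hu
      have ha : (a : ℝ) ≤ n₁ := by exact_mod_cast hlt.le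
      have hexp : (1 : ℝ) ≤ (1 + ε₀) ^ ((1 + η) * n₁) * (1 + ε₀) ^ (-((1 + η) * (a : ℝ))) := by
        rw [← Real.rpow_add h0]
        refine Real.one_le_rpow h1 ?_
        nlinarith [mul_nonneg (by linarith : (0 : ℝ) ≤ 1 + η) (sub_nonneg.2 ha)]
      calc T a u ≤ E₀ := h
        _ = E₀ * 1 := (mul_one _).symm
        _ ≤ E₀ * ((1 + ε₀) ^ ((1 + η) * n₁) * (1 + ε₀) ^ (-((1 + η) * (a : ℝ)))) :=
            mul_le_mul_of_nonneg_left hexp hE0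
        _ = (E₀ * (1 + ε₀) ^ ((1 + η) * n₁)) * (1 + ε₀) ^ (-((1 + η) * (a : ℝ))) := by ring
  -- finite blocks are below the tail
  have hsn : Summable fun j : ℕ => ∑ i : Fin 4, (1 / 2 : ℝ) * X i ((n + j : ℕ) : ℤ) t ^ 2 :=
    (hsum n t).congr fun j => by simp [Nat.cast_add]
  have hpart := orthantBreak_partial_le (hnonneg t) n N hsn
  have h2 : ∑' j : ℕ, ∑ i : Fin 4, (1 / 2 : ℝ) * X i ((n + j : ℕ) : ℤ) t ^ 2 = T n t := by
    simp only [hT, Nat.cast_add]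
  rw [h2] at hpart
  exact hpart.trans (hTall n t ht)

/-! ## The item -/

/-- **Item stmt-NavierStokesRegularity-24641** (`OrthantWake.OrthantBreakOfWake`): the per-hop
tail-energy ratchet (`OrthantHopWake`) and Kamke cone invariance (`OrthantInvariance`) imply the
orthant conjunct of the rung target — for every `R ≥ 1` there is `εR > 0` such that for
`ε₀ ≤ εR` no orthant table of `E₂(R)` exhibits Theorem-4.2-level blow-up from any one-shell
datum. MODEL lattice statement; no Navier–Stokes statement is proved. [this file] -/
theorem orthantBreakOfWake_proof :
    Summit.NavierStokesRegularity.NavierStokesRegularity.Theses.OrthantWake.OrthantBreakOfWake := by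
  unfold Summit.NavierStokesRegularity.NavierStokesRegularity.Theses.OrthantWake.OrthantBreakOfWake
    Summit.NavierStokesRegularity.NavierStokesRegularity.Theses.OrthantWake.OrthantHopWake
    Summit.NavierStokesRegularity.NavierStokesRegularity.Theses.OrthantWake.OrthantInvariance
  intro hW hI R hR
  obtain ⟨η, hη, κ₁, _hκ₁, εb, hεb, _hεb1, H⟩ := hW R hR
  refine ⟨εb, hεb, fun ε₀ hε₀ hle α X₀ hα hK hNG => ?_⟩
  obtain ⟨κ, hκ, hno⟩ := (noGlobalCascade_iff_kappa hε₀).1 hNG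
  have h2 : 0 < Real.sqrt 2 := Real.sqrt_pos.2 two_pos
  have hν : 0 < κ / Real.sqrt 2 := div_pos hκ h2
  -- the transient depth in shells and the envelope constant
  obtain ⟨n₁, hn₁⟩ : ∃ n₁ : ℕ, κ₁ ≤ ε₀ * n₁ := by
    refine ⟨⌈κ₁ / ε₀⌉₊, ?_⟩
    have := Nat.le_ceil (κ₁ / ε₀)
    rwa [div_le_iff₀' hε₀] at this
  obtain ⟨X, hX⟩ := exists_viscousGlobal_of_subcriticalEnvelope_of_inTableClass hε₀.le hη hν hα X₀
    (fun T _hT => ⟨(∑ i : Fin 4, (1 / 2 : ℝ) * X₀ i ^ 2) * (1 + ε₀) ^ ((1 + η) * n₁),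
      fun s hs Y hinit hlow hbd hcont hder n N _hnN t ht => by
        obtain ⟨M, hM⟩ := hbd
        have hnonneg := hI ε₀ (κ / Real.sqrt 2) hε₀ hν α hK X₀ s hs.1 Y hinit hlow ⟨M, hM⟩
          hcont hder
        have hrat := H ε₀ hε₀ hle (κ / Real.sqrt 2) hν α hα hK X₀ s hs.1 Y hinit hlow ⟨M, hM⟩
          hcont hder hnonneg
        exact orthantBreak_envelope hε₀ hn₁ (orthantBreak_summable hε₀ hM)
          (fun u hu => orthantBreak_energy_le hε₀ hν hα.2.1 hinit hlow hM hder hu) hrat hη n N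
          ht⟩)
  have hG := hasGlobal_of_viscousGlobal hε₀ hν.le hX
  rw [div_mul_cancel₀ κ h2.ne'] at hG
  exact hno (hasGlobal_mono hε₀.le hG le_rfl hκ.le)

end Summit.NavierStokesRegularity.NavierStokesRegularity.Theorems

end
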